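import Literature.Probability.Percolation.ArmSeparationFourArm
import Literature.Probability.Percolation.AnnulusOrderTransfer
import HarnessLib

/-!
# From four fenced arms of alternating colours to the well-separated four-arm event

Topic `Literature/Probability/Percolation`; family `crit-perc` / near-critical percolation on `𝕋`.
The last deterministic step of the near-critical arm-separation theorem for four arms of
alternating colours (P. Nolin, *Near-critical percolation in two dimensions*, EJP 13 (2008),
Thm. 11 for `j = 4`, `σ = BWBW` [arXiv 0711.4948: Thm. 10]; §4.2, "arms of the same colour must be
required to be disjoint; arms of different colours are disjoint automatically"): if `ω` carries a
fenced open arm landing on the sides `0` and `3` (`rotConfig 0 ω, rotConfig 3 ω ∈ sepOpenArm n N`)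
and a fenced closed arm landing on the sides `1` and `4` (`rotConfig 1 ωᶜ, rotConfig 4 ωᶜ ∈ sepOpenArm n N`),
then `ω ∈ sepFourArm n N` (`sepFourArm_of_arms`): the confining sets are the supports of the arms
(`arm_data`), and two arms of the same colour are disjoint because a common site would give a path
of that colour of the disc `Λ_{N+1}` between the outer attaching sites of the two arms, on the sides
`0, 3` (resp. `1, 4`) of `∂Λ_{N+1}`, while the two arms of the other colour, joined through the hole
`Λ̊_n` off the free spaces, give a path of the disc off it between the sides `1, 4` (resp. `3, 0`)
— impossible in a disc (`triBall_not_interleaved_shift`). Everything here is proved; no named facts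
are introduced.

## References

* P. Nolin, Near-critical percolation in two dimensions, *Electron. J. Probab.* 13 (2008), §4.2
  (well-separateness; arXiv 0711.4948: Def. 6–8) and Thm. 11 [Nolin2008].
* B. Bollobás, O. Riordan, *Percolation*, CUP 2006, Ch. 7 Lemma 5 p. 169 (disc crossings) [BollobasRiordan2006].
-/

noncomputable section

open Set

namespace Literature.Probability.Percolation

open LatticeModels

/-! ### Straight segments with integer endpoints; first reach of a level -/

/-- A horizontal segment inside `S` joins `(a, r)` to `(b, r)`, `a ≤ b` (from `pathIn_hSegment`,
`ArmSeparationNonvacuity.lean`). [folklore] -/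
private theorem pathIn_hseg' {S : Set (Site 2)} {a b r : ℤ} (hab : a ≤ b) (h : ∀ t : ℤ, a ≤ t → t ≤ b → (![t, r] : Site 2) ∈ S) :
    PathIn triGraph S ![a, r] ![b, r] := by
  obtain ⟨J, rfl⟩ : ∃ J : ℕ, b = a + J := ⟨(b - a).toNat, by omega⟩
  exact pathIn_hSegment J fun k _ => h _ (by omega) (by omega)

/-- A vertical segment inside `S` joins `(c, a)` to `(c, b)`, `a ≤ b` (from `pathIn_vSegment_up`,
`ArmSeparationNonvacuity.lean`). [folklore] -/
private theorem pathIn_vseg' {S : Set (Site 2)} {c a b : ℤ} (hab : a ≤ b) (h : ∀ t : ℤ, a ≤ t → t ≤ b → (![c, t] : Site 2) ∈ S) :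
    PathIn triGraph S ![c, a] ![c, b] := by
  obtain ⟨J, rfl⟩ : ∃ J : ℕ, b = a + J := ⟨(b - a).toNat, by omega⟩
  exact pathIn_vSegment_up J fun k _ => h _ (by omega) (by omega)

/-- **First reach of a level**: a path from a site of norm `≤ K` to a site of norm `≥ K` reaches
`∂Λ_K` first inside `Λ_K`. [folklore] -/
theorem PathIn.exists_first_level_ball {A : Set (Site 2)} {a b : Site 2} {K : ℕ} (hp : PathIn triGraph A a b)
    (ha : triNorm a ≤ K) (hb : (K : ℤ) ≤ triNorm b) :
    ∃ t : Site 2, triNorm t = K ∧ PathIn triGraph ((↑(triBall K) : Set (Site 2)) ∩ A) a t := by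
  rcases ha.lt_or_eq with hlt | heq
  · obtain ⟨a', b', ha', hb', hb'X, hadj, hq⟩ :=
      hp.exit (R := {v : Site 2 | triNorm v < K}) hlt (by simp only [Set.mem_setOf_eq, not_lt]; exact hb)
    simp only [Set.mem_setOf_eq, not_lt] at ha' hb'
    have h1 := triNorm_le_triNorm_add_one_of_adj hadj
    have hbN : triNorm b' = K := by omega
    refine ⟨b', hbN, (hq.mono ?_).tail hadj ⟨Finset.mem_coe.2 (mem_triBall_iff.2 hbN.le), hb'X⟩⟩
    rintro v ⟨hv, hvA⟩
    exact ⟨Finset.mem_coe.2 (mem_triBall_iff.2 (le_of_lt hv)), hvA⟩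
  · exact ⟨a, heq, PathIn.refl ⟨Finset.mem_coe.2 (mem_triBall_iff.2 ha), hp.left_mem⟩⟩

/-! ### The support of a fenced arm -/

/-- **The support of a fenced open arm.** A configuration `χ` with a fenced open arm has a set of
open sites `X` in the cone support carrying the arm (`χ ∈ sepOpenArmIn X n N`), containing the
inner attaching site `u` (inside the inner free space) and joining each of its sites of norm `≤ N`
to a site of norm `N + 1` inside `Λ_{N+1}` (`4 ≤ n ≤ N`). [cite: Nolin2008, §4.2 Def. 6–8 (arXiv 0711.4948)] -/
theorem arm_data {n N : ℕ} (h4 : 4 ≤ n) (hnN : n ≤ N) {χ : SiteConfig (Site 2)} (h : χ ∈ sepOpenArm n N) :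
    ∃ (X : Set (Site 2)) (u : Site 2), X ⊆ sepConeSupport n N ∧ X ⊆ χ ∧ χ ∈ sepOpenArmIn X n N ∧ u ∈ X ∧
      (n : ℤ) - (n / 8 : ℕ) ≤ u 0 ∧ u 0 ≤ (n : ℤ) - 1 ∧ -(n : ℤ) + (n / 4 : ℕ) - (n / 64 : ℕ) ≤ u 1 ∧ u 1 ≤ -((n / 4 : ℕ) : ℤ) + (n / 64 : ℕ) ∧
      ∀ w ∈ X, triNorm w ≤ N → ∃ x : Site 2, triNorm x = (N + 1 : ℕ) ∧
        PathIn triGraph ((↑(triBall (N + 1)) : Set (Site 2)) ∩ X) w x := by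
  rw [← sepOpenArmIn_univ] at h
  obtain ⟨z, z', u, u', hz, hz', ⟨b, t, hb, ht, p₁, p₂⟩, ⟨b', t', hb', ht', p₃, p₄⟩, p₅⟩ := mem_sepOpenArmIn_inter_support h4 hnN h
  obtain ⟨S₁, hS₁, q₁, T₁⟩ := p₁.symm.exists_support
  obtain ⟨S₂, hS₂, q₂, T₂⟩ := p₂.exists_support
  obtain ⟨S₃, hS₃, q₃, T₃⟩ := p₃.symm.exists_support
  obtain ⟨S₄, hS₄, q₄, T₄⟩ := p₄.exists_support
  obtain ⟨S₅, hS₅, q₅, T₅⟩ := p₅.symm.exists_support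
  set X := S₁ ∪ S₂ ∪ S₃ ∪ S₄ ∪ S₅ with hX
  have i1 : S₁ ⊆ X := fun v hv => Or.inl (Or.inl (Or.inl (Or.inl hv)))
  have i2 : S₂ ⊆ X := fun v hv => Or.inl (Or.inl (Or.inl (Or.inr hv)))
  have i3 : S₃ ⊆ X := fun v hv => Or.inl (Or.inl (Or.inr hv))
  have i4 : S₄ ⊆ X := fun v hv => Or.inl (Or.inr hv)
  have i5 : S₅ ⊆ X := fun v hv => Or.inr hv
  have hXT : X ⊆ sepConeSupport n N := by
    rintro v ((((hv | hv) | hv) | hv) | hv)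
    exacts [(hS₁ hv).1.2.2, (hS₂ hv).1.2.2, (hS₃ hv).1.2.2, (hS₄ hv).1.2.2, (hS₅ hv).1.2.2]
  have hXχ : X ⊆ χ := by
    rintro v ((((hv | hv) | hv) | hv) | hv)
    exacts [(hS₁ hv).2, (hS₂ hv).2, (hS₃ hv).2, (hS₄ hv).2, (hS₅ hv).2]
  have huS₅ : u ∈ S₅ := q₅.right_mem
  have hu'S₅ : u' ∈ S₅ := q₅.left_mem
  -- membership in `sepOpenArmIn X`
  have m1 : S₁ ⊆ sepInnerFence n z' ∩ X ∩ χ := fun v hv => ⟨⟨(hS₁ hv).1.1, i1 hv⟩, (hS₁ hv).2⟩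
  have m2 : S₂ ⊆ sepInnerFence n z' ∩ X ∩ χ := fun v hv => ⟨⟨(hS₂ hv).1.1, i2 hv⟩, (hS₂ hv).2⟩
  have m3 : S₃ ⊆ sepOuterFence N z ∩ X ∩ χ := fun v hv => ⟨⟨(hS₃ hv).1.1, i3 hv⟩, (hS₃ hv).2⟩
  have m4 : S₄ ⊆ sepOuterFence N z ∩ X ∩ χ := fun v hv => ⟨⟨(hS₄ hv).1.1, i4 hv⟩, (hS₄ hv).2⟩
  have m5 : S₅ ⊆ sepJoinRegion n N z z' ∩ X ∩ χ := fun v hv => ⟨⟨(hS₅ hv).1.1, i5 hv⟩, (hS₅ hv).2⟩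
  have hmem : χ ∈ sepOpenArmIn X n N :=
    ⟨z, z', u, u', hz, hz', ⟨b, t, hb, ht, q₁.symm.mono m1, q₂.mono m2⟩, ⟨b', t', hb', ht', q₃.symm.mono m3, q₄.mono m4⟩,
      q₅.symm.mono m5⟩
  -- coordinates of `u`
  have huF : u ∈ sepInnerFence n z' := (p₁.right_mem).1.1
  rw [mem_sepInnerFence] at huF
  rw [mem_sepLanding] at hz'
  -- the outer attaching site is beyond `Λ_N`
  have hu'F : u' ∈ sepOuterFence N z := (p₃.right_mem).1.1
  rw [mem_sepOuterFence] at hu'F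
  have hu'n : ((N + 1 : ℕ) : ℤ) ≤ triNorm u' := by push_cast; exact le_triNorm_iff_lin.2 (Or.inl hu'F.1)
  refine ⟨X, u, hXT, hXχ, hmem, i5 huS₅, huF.1, huF.2.1, by omega, by omega, fun w hw hwN => ?_⟩
  -- from `w` to `u'` inside `X`
  have hwu' : PathIn triGraph X w u' := by
    rcases hw with ((((hv | hv) | hv) | hv) | hv)
    · exact ((T₁ w hv).symm.mono i1).trans ((T₅ u huS₅).symm.mono i5)
    · exact ((T₂ w hv).symm.mono i2).trans ((T₅ u huS₅).symm.mono i5)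
    · exact (T₃ w hv).symm.mono i3
    · exact (T₄ w hv).symm.mono i4
    · exact (T₅ w hv).symm.mono i5
  have hwN' : triNorm w ≤ (N + 1 : ℕ) := by push_cast; omega
  exact hwu'.exists_first_level_ball hwN' hu'n

/-! ### Sectors and perimeter coordinates -/

/-- A site of the cone support of norm `> N` or `< n` lies on the open right side of its hexagon. [folklore] -/
theorem side0_of_mem_sepConeSupport {n N : ℕ} {v : Site 2} (hv : v ∈ sepConeSupport n N) {K : ℕ}
    (hK : triNorm v = K) (hout : triNorm v < n ∨ (N : ℤ) < triNorm v) :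
    v = ![(K : ℤ), v 1] ∧ -(K : ℤ) < v 1 ∧ v 1 < 0 := by
  have hc := mem_triCone.1 (hv.2.2 hout)
  have h1 := triNorm_le_iff_lin.1 hK.le
  have h2 := le_triNorm_iff_lin.1 hK.ge
  refine ⟨site_eq_vec2 (by omega) rfl, by omega, by omega⟩

/-- **Perimeter coordinates of the rotated side-`0` points**: `hexPos K (ρ^i (K, y)) ∈ [iK, (i+1)K)`
for `-K < y < 0`. [folklore] -/
theorem hexPos_rot_block {K i : ℕ} (hi : i < 6) {y : ℤ} (hy : -(K : ℤ) < y) (hy0 : y < 0) :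
    (i : ℤ) * K < hexPos K (triRotIsoPow i ![(K : ℤ), y]) ∧ hexPos K (triRotIsoPow i ![(K : ℤ), y]) < ((i : ℤ) + 1) * K := by
  rw [hexPos_rot_side0 hi hy.le hy0]
  constructor <;> nlinarith

/-- `hexShift N r r < hexShift N r v` when `hexPos r < hexPos v`. [folklore] -/
theorem hexShift_self_lt {N : ℕ} {r v : Site 2} (h : hexPos N r < hexPos N v) : hexShift N r r < hexShift N r v := by
  unfold hexShift; split_ifs <;> omega

/-- Monotonicity of `hexShift N r ·` beyond `r`. [folklore] -/
theorem hexShift_lt_of_le_of_lt {N : ℕ} {r v w : Site 2} (h1 : hexPos N r ≤ hexPos N v) (h2 : hexPos N v < hexPos N w) :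
    hexShift N r v < hexShift N r w := by
  unfold hexShift; split_ifs <;> omega

/-- The wrapped comparison: a point before `r` comes last. [folklore] -/
theorem hexShift_lt_wrap {N : ℕ} {r c d : Site 2} (hc : hexPos N r ≤ hexPos N c) (hc6 : hexPos N c < 6 * (N : ℤ))
    (hd : hexPos N d < hexPos N r) (hd0 : 0 ≤ hexPos N d) : hexShift N r c < hexShift N r d := by
  unfold hexShift; split_ifs <;> omega

/-! ### The hole paths -/

section Hole

variable {n : ℕ}

/-- The hole path of the closed pair: from `ρ¹ u₁` (side `1`) to `ρ⁴ u₄` (side `4`) through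
`(a, 0)`, `(a', 0)`, inside `Λ_{n-1}` and off the sectors `0`, `3`. [folklore] -/
theorem hole_path_14 (hn : 64 ≤ n) {S : Set (Site 2)}
    (hS : ∀ v : Site 2, triNorm v ≤ (n : ℤ) - 1 → ¬ (0 < v 0 ∧ v 1 < 0 ∧ 0 < v 0 + v 1) → ¬ (v 0 < 0 ∧ 0 < v 1 ∧ v 0 + v 1 < 0) → v ∈ S)
    {p q : Site 2} (hp0 : 0 ≤ p 0) (hp1 : 0 ≤ p 1) (hpn : triNorm p ≤ (n : ℤ) - 1)
    (hq0 : q 0 ≤ 0) (hq1 : q 1 ≤ 0) (hqn : triNorm q ≤ (n : ℤ) - 1) : PathIn triGraph S p q := by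
  have hpmax := triNorm_eq_max p
  have hqmax := triNorm_eq_max q
  have ep : p = ![p 0, p 1] := site_eq_vec2 rfl rfl
  have eq' : q = ![q 0, q 1] := site_eq_vec2 rfl rfl
  -- down the column of `p` to the axis
  have P1 : PathIn triGraph S ![p 0, 0] ![p 0, p 1] := by
    refine pathIn_vseg' hp1 fun t ht0 ht1 => hS _ (triNorm_le_iff_lin.2 ?_) ?_ ?_
    · simp only [site_mk_apply_zero, site_mk_apply_one]; omega
    · simp only [site_mk_apply_zero, site_mk_apply_one]; omega
    · simp only [site_mk_apply_zero, site_mk_apply_one]; omega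
  -- along the axis
  have P2 : PathIn triGraph S ![q 0, 0] ![p 0, 0] := by
    refine pathIn_hseg' (by omega) fun t ht0 ht1 => hS _ (triNorm_le_iff_lin.2 ?_) ?_ ?_
    · simp only [site_mk_apply_zero, site_mk_apply_one]; omega
    · simp only [site_mk_apply_zero, site_mk_apply_one]; omega
    · simp only [site_mk_apply_zero, site_mk_apply_one]; omega
  -- down the column of `q`
  have P3 : PathIn triGraph S ![q 0, q 1] ![q 0, 0] := by
    refine pathIn_vseg' hq1 fun t ht0 ht1 => hS _ (triNorm_le_iff_lin.2 ?_) ?_ ?_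
    · simp only [site_mk_apply_zero, site_mk_apply_one]; omega
    · simp only [site_mk_apply_zero, site_mk_apply_one]; omega
    · simp only [site_mk_apply_zero, site_mk_apply_one]; omega
  rw [ep, eq']
  exact (P1.symm.trans P2.symm).trans P3.symm

/-- The hole path of the open pair: from `u₀` (side `0`) to `ρ³ u₃` (side `3`) through `(0, u₀ 1)`,
`(0, -u₃ 1)`, inside `Λ_{n-1}` and off the sectors `1`, `4`. [folklore] -/
theorem hole_path_03 (hn : 64 ≤ n) {S : Set (Site 2)}
    (hS : ∀ v : Site 2, triNorm v ≤ (n : ℤ) - 1 → ¬ (0 < v 0 ∧ 0 < v 1) → ¬ (v 0 < 0 ∧ v 1 < 0) → v ∈ S)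
    {p q : Site 2} (hp0 : 0 ≤ p 0) (hp1 : p 1 ≤ 0) (hpn : triNorm p ≤ (n : ℤ) - 1)
    (hq0 : q 0 ≤ 0) (hq1 : 0 ≤ q 1) (hqn : triNorm q ≤ (n : ℤ) - 1) : PathIn triGraph S p q := by
  have hpmax := triNorm_eq_max p
  have hqmax := triNorm_eq_max q
  have ep : p = ![p 0, p 1] := site_eq_vec2 rfl rfl
  have eq' : q = ![q 0, q 1] := site_eq_vec2 rfl rfl
  -- along the row of `p` to the axis `x₀ = 0`
  have P1 : PathIn triGraph S ![0, p 1] ![p 0, p 1] := by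
    refine pathIn_hseg' hp0 fun t ht0 ht1 => hS _ (triNorm_le_iff_lin.2 ?_) ?_ ?_
    · simp only [site_mk_apply_zero, site_mk_apply_one]; omega
    · simp only [site_mk_apply_zero, site_mk_apply_one]; omega
    · simp only [site_mk_apply_zero, site_mk_apply_one]; omega
  -- up the axis
  have P2 : PathIn triGraph S ![0, p 1] ![0, q 1] := by
    refine pathIn_vseg' (by omega) fun t ht0 ht1 => hS _ (triNorm_le_iff_lin.2 ?_) ?_ ?_
    · simp only [site_mk_apply_zero, site_mk_apply_one]; omega
    · simp only [site_mk_apply_zero, site_mk_apply_one]; omega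
    · simp only [site_mk_apply_zero, site_mk_apply_one]; omega
  -- along the row of `q`
  have P3 : PathIn triGraph S ![q 0, q 1] ![0, q 1] := by
    refine pathIn_hseg' hq0 fun t ht0 ht1 => hS _ (triNorm_le_iff_lin.2 ?_) ?_ ?_
    · simp only [site_mk_apply_zero, site_mk_apply_one]; omega
    · simp only [site_mk_apply_zero, site_mk_apply_one]; omega
    · simp only [site_mk_apply_zero, site_mk_apply_one]; omega
  rw [ep, eq']
  exact (P1.symm.trans P2).trans P3.symm

end Hole

/-! ### The main lemma -/

/-- Transport of a support path of the arm read in the frame `i` back to the original coordinates. [folklore] -/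
theorem pathIn_image_rot {i : ℕ} {X A : Set (Site 2)} {w x : Site 2}
    (h : PathIn triGraph (A ∩ X) w x) :
    PathIn triGraph ((triRotIsoPow i '' A) ∩ (triRotIsoPow i '' X)) (triRotIsoPow i w) (triRotIsoPow i x) := by
  refine (pathIn_map_iso (triRotIsoPow i) h).mono ?_
  rintro _ ⟨v, ⟨hvA, hvX⟩, rfl⟩
  exact ⟨⟨v, hvA, rfl⟩, ⟨v, hvX, rfl⟩⟩

/-- The image of the disc `Λ_K` under a rotation is `Λ_K`. [folklore] -/
theorem image_rot_triBall (i K : ℕ) : triRotIsoPow i '' (↑(triBall K) : Set (Site 2)) ⊆ ↑(triBall K) := by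
  rintro _ ⟨v, hv, rfl⟩
  rw [Finset.mem_coe, mem_triBall_iff] at hv ⊢
  rwa [show ((triRotIsoPow i : triGraph ≃g triGraph) v) = triRotIsoPow i v from rfl, triNorm_rot]

set_option maxHeartbeats 400000 in
/-- **Four fenced arms of alternating colours form the well-separated four-arm event.** For
`64 ≤ n`, `2n ≤ N`: if `ω` read in the frames `0, 3` has a fenced open arm and `ωᶜ` read in the
frames `1, 4` has one, then `ω ∈ sepFourArm n N` (the confining sets are the supports; arms of the
same colour are disjoint by the disc-crossing lemma, the other two arms being joined through the
hole off the free spaces). [cite: Nolin2008, §4.2 (well-separateness, arXiv 0711.4948: Def. 6–8) and Thm. 11] -/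
theorem sepFourArm_of_arms {n N : ℕ} (hn : 64 ≤ n) (hnN : 2 * n ≤ N) {ω : SiteConfig (Site 2)}
    (h0 : rotConfig 0 ω ∈ sepOpenArm n N) (h3 : rotConfig 3 ω ∈ sepOpenArm n N)
    (h1 : rotConfig 1 ωᶜ ∈ sepOpenArm n N) (h4 : rotConfig 4 ωᶜ ∈ sepOpenArm n N) : ω ∈ sepFourArm n N := by
  have h4n : 4 ≤ n := by omega
  have hnN' : n ≤ N := by omega
  obtain ⟨X₀, u₀, hT₀, hχ₀, hA₀, hu₀, a₀, b₀, c₀, d₀, R₀⟩ := arm_data h4n hnN' h0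
  obtain ⟨X₃, u₃, hT₃, hχ₃, hA₃, hu₃, a₃, b₃, c₃, d₃, R₃⟩ := arm_data h4n hnN' h3
  obtain ⟨X₁, u₁, hT₁, hχ₁, hA₁, hu₁, a₁, b₁, c₁, d₁, R₁⟩ := arm_data h4n hnN' h1
  obtain ⟨X₄, u₄, hT₄, hχ₄, hA₄, hu₄, a₄, b₄, c₄, d₄, R₄⟩ := arm_data h4n hnN' h4
  set K := N + 1 with hK
  have hK1 : 1 ≤ K := by omega
  -- the confining sets, in the original coordinates
  set Y₀ := triRotIsoPow 0 '' X₀ with hY₀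
  set Y₃ := triRotIsoPow 3 '' X₃ with hY₃
  set Y₁ := triRotIsoPow 1 '' X₁ with hY₁
  set Y₄ := triRotIsoPow 4 '' X₄ with hY₄
  have pre : ∀ (i : ℕ) (X : Set (Site 2)), (triRotIsoPow i) ⁻¹' (triRotIsoPow i '' X) = X := fun i X =>
    Set.preimage_image_eq X (triRotIsoPow i).injective
  have memAt : ∀ (i : ℕ) (b : Bool) (X : Set (Site 2)), rotConfig i {v : Site 2 | v ∈ ω ↔ b} ∈ sepOpenArmIn X n N →
      ω ∈ sepArmAt i b (triRotIsoPow i '' X) n N := fun i b X h => by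
    rw [mem_sepArmAt, pre]; exact h
  have hωt : {v : Site 2 | v ∈ ω ↔ true} = ω := setOf_mem_iff_true ω
  have hωf : {v : Site 2 | v ∈ ω ↔ false} = ωᶜ := setOf_mem_iff_false ω
  -- norms of support sites, transported
  have normY : ∀ {i : ℕ} {X : Set (Site 2)} {v : Site 2}, v ∈ triRotIsoPow i '' X → X ⊆ sepConeSupport n N →
      ∃ w ∈ X, v = triRotIsoPow i w ∧ triNorm v = triNorm w := by
    rintro i X _ ⟨w, hw, rfl⟩ hX
    exact ⟨w, hw, rfl, triNorm_rot i w⟩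
  -- (A) the open arms are disjoint
  have hD03 : Disjoint Y₀ Y₃ := by
    rw [Set.disjoint_left]
    rintro v hv0 hv3
    obtain ⟨w₀, hw₀, ev0, nv0⟩ := normY hv0 hT₀
    obtain ⟨w₃, hw₃, ev3, nv3⟩ := normY hv3 hT₃
    -- the common site lies in the closed annulus
    have hann : (n : ℤ) ≤ triNorm v ∧ triNorm v ≤ N := by
      by_contra hc
      have hout : triNorm v < n ∨ (N : ℤ) < triNorm v := by omega
      have c0 := (hT₀ hw₀).2.2 (by rw [← nv0]; exact hout)
      have c3 := (hT₃ hw₃).2.2 (by rw [← nv3]; exact hout)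
      obtain ⟨-, -, -, -, -, -, f30, f31, -⟩ := rot_apply_formula w₃
      have e0 : v = w₀ := by rw [ev0]; rfl
      rw [mem_triCone] at c0 c3
      rw [e0] at ev3
      have h30 : w₀ 0 = -w₃ 0 := by rw [ev3]; exact f30
      have h31 : w₀ 1 = -w₃ 1 := by rw [ev3]; exact f31
      omega
    -- paths of `ω` from `v` to the sides `0` and `3` of `∂Λ_K`
    obtain ⟨x₀, hx₀, P₀⟩ := R₀ w₀ hw₀ (by rw [← nv0]; exact hann.2)
    obtain ⟨x₃, hx₃, P₃⟩ := R₃ w₃ hw₃ (by rw [← nv3]; exact hann.2)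
    have hx₀T := side0_of_mem_sepConeSupport (hT₀ P₀.right_mem.2) hx₀ (Or.inr (by rw [hx₀]; omega))
    have hx₃T := side0_of_mem_sepConeSupport (hT₃ P₃.right_mem.2) hx₃ (Or.inr (by rw [hx₃]; omega))
    set B : Set (Site 2) := Y₀ ∪ Y₃ with hB
    have Q₀ : PathIn triGraph ((↑(triBall K) : Set (Site 2)) ∩ B) v (triRotIsoPow 0 x₀) := by
      have h := pathIn_image_rot (i := 0) P₀
      rw [← ev0] at h
      exact h.mono fun z hz => ⟨image_rot_triBall 0 K hz.1, Or.inl hz.2⟩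
    have Q₃ : PathIn triGraph ((↑(triBall K) : Set (Site 2)) ∩ B) v (triRotIsoPow 3 x₃) := by
      have h := pathIn_image_rot (i := 3) P₃
      rw [← ev3] at h
      exact h.mono fun z hz => ⟨image_rot_triBall 3 K hz.1, Or.inr hz.2⟩
    have hP : PathIn triGraph ((↑(triBall K) : Set (Site 2)) ∩ B) (triRotIsoPow 0 x₀) (triRotIsoPow 3 x₃) := Q₀.symm.trans Q₃
    -- paths of `ωᶜ` (off `B ⊆ ω`) from the sides `1`, `4` to the hole, and the hole path
    have hBω : B ⊆ ω := by
      rintro z (⟨w, hw, rfl⟩ | ⟨w, hw, rfl⟩)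
      · have := hχ₀ hw; rw [mem_rotConfig] at this; exact this
      · have := hχ₃ hw; rw [mem_rotConfig] at this; exact this
    have hu₁n : triNorm u₁ ≤ N := by
      have : triNorm u₁ ≤ (n : ℤ) - 1 := triNorm_le_iff_lin.2 (by omega)
      omega
    have hu₄n : triNorm u₄ ≤ N := by
      have : triNorm u₄ ≤ (n : ℤ) - 1 := triNorm_le_iff_lin.2 (by omega)
      omega
    obtain ⟨y₁, hy₁, P₁⟩ := R₁ u₁ hu₁ hu₁n
    obtain ⟨y₄, hy₄, P₄⟩ := R₄ u₄ hu₄ hu₄n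
    have hy₁T := side0_of_mem_sepConeSupport (hT₁ P₁.right_mem.2) hy₁ (Or.inr (by rw [hy₁]; omega))
    have hy₄T := side0_of_mem_sepConeSupport (hT₄ P₄.right_mem.2) hy₄ (Or.inr (by rw [hy₄]; omega))
    have offB : ∀ {i : ℕ} {X : Set (Site 2)}, X ⊆ rotConfig i ωᶜ → ∀ z ∈ triRotIsoPow i '' X, z ∉ B := by
      rintro i X hX _ ⟨w, hw, rfl⟩ hzB
      have h1 := hX hw; rw [mem_rotConfig] at h1
      exact h1 (hBω hzB)
    have Q₁ : PathIn triGraph ((↑(triBall K) : Set (Site 2)) ∩ Bᶜ) (triRotIsoPow 1 y₁) (triRotIsoPow 1 u₁) := by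
      have h := pathIn_image_rot (i := 1) P₁
      refine (h.mono ?_).symm
      exact fun z hz => ⟨image_rot_triBall 1 K hz.1, offB hχ₁ z hz.2⟩
    have Q₄ : PathIn triGraph ((↑(triBall K) : Set (Site 2)) ∩ Bᶜ) (triRotIsoPow 4 u₄) (triRotIsoPow 4 y₄) := by
      have h := pathIn_image_rot (i := 4) P₄
      exact h.mono fun z hz => ⟨image_rot_triBall 4 K hz.1, offB hχ₄ z hz.2⟩
    -- the hole path, off the sectors `0` and `3` (where the sites of `B` of norm `< n` lie)
    obtain ⟨-, -, f10, f11, -, -, -, -, f40, f41, -⟩ := rot_apply_formula u₁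
    obtain ⟨-, -, -, -, -, -, -, -, g40, g41, -⟩ := rot_apply_formula u₄
    have hu₁max := triNorm_eq_max u₁
    have hu₄max := triNorm_eq_max u₄
    have H : PathIn triGraph ((↑(triBall K) : Set (Site 2)) ∩ Bᶜ) (triRotIsoPow 1 u₁) (triRotIsoPow 4 u₄) := by
      refine hole_path_14 hn (S := (↑(triBall K) : Set (Site 2)) ∩ Bᶜ) (fun z hz hc0 hc3 => ⟨?_, fun hzB => ?_⟩) ?_ ?_ ?_ ?_ ?_ ?_
      · exact Finset.mem_coe.2 (mem_triBall_iff.2 (by rw [hK]; push_cast; omega))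
      · rcases hzB with hzB | hzB
        · obtain ⟨w, hw, ez, nz⟩ := normY hzB hT₀
          have hs := hT₀ hw
          rw [mem_sepConeSupport] at hs
          have hc := hs.2.2 (Or.inl (by rw [← nz]; omega))
          have e0 : z = w := by rw [ez]; rfl
          rw [e0] at hc0; exact hc0 hc
        · obtain ⟨w, hw, ez, nz⟩ := normY hzB hT₃
          have hs := hT₃ hw
          rw [mem_sepConeSupport] at hs
          have hc := hs.2.2 (Or.inl (by rw [← nz]; omega))
          obtain ⟨-, -, -, -, -, -, e30, e31, -⟩ := rot_apply_formula w
          rw [ez] at hc3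
          apply hc3
          rw [e30, e31]; omega
      · rw [f10]; omega
      · rw [f11]; omega
      · rw [triNorm_rot]; exact triNorm_le_iff_lin.2 (by omega)
      · rw [g40]; omega
      · rw [g41]; omega
      · rw [triNorm_rot]; exact triNorm_le_iff_lin.2 (by omega)
    have hQ : PathIn triGraph ((↑(triBall K) : Set (Site 2)) ∩ Bᶜ) (triRotIsoPow 1 y₁) (triRotIsoPow 4 y₄) := (Q₁.trans H).trans Q₄
    -- perimeter coordinates and the disc-crossing lemma
    obtain ⟨ex0, l0, r0⟩ := hx₀T; obtain ⟨ex3, l3, r3⟩ := hx₃T; obtain ⟨ey1, l1, r1⟩ := hy₁T; obtain ⟨ey4, l4, r4⟩ := hy₄T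
    have b0 := hexPos_rot_block (K := K) (i := 0) (by norm_num) l0 r0
    have b3 := hexPos_rot_block (K := K) (i := 3) (by norm_num) l3 r3
    have b1 := hexPos_rot_block (K := K) (i := 1) (by norm_num) l1 r1
    have b4 := hexPos_rot_block (K := K) (i := 4) (by norm_num) l4 r4
    have n0 : triNorm (triRotIsoPow 0 ![(K : ℤ), x₀ 1]) = K := by rw [triNorm_rot, ← ex0, hx₀]
    have n3 : triNorm (triRotIsoPow 3 ![(K : ℤ), x₃ 1]) = K := by rw [triNorm_rot, ← ex3, hx₃]
    have n1 : triNorm (triRotIsoPow 1 ![(K : ℤ), y₁ 1]) = K := by rw [triNorm_rot, ← ey1, hy₁]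
    have n4 : triNorm (triRotIsoPow 4 ![(K : ℤ), y₄ 1]) = K := by rw [triNorm_rot, ← ey4, hy₄]
    rw [ex0, ex3] at hP
    rw [ey1, ey4] at hQ
    push_cast at b0 b3 b1 b4
    exact triBall_not_interleaved_shift hK1 B n0 n0 n1 n3 n4 (hexShift_self_lt (by linarith [b0.1, b1.1, b0.2]))
      (hexShift_lt_of_le_of_lt (by linarith [b0.2, b1.1]) (by linarith [b1.2, b3.1]))
      (hexShift_lt_of_le_of_lt (by linarith [b0.2, b3.1]) (by linarith [b3.2, b4.1])) hP hQ
  -- (B) the closed arms are disjoint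
  have hD14 : Disjoint Y₁ Y₄ := by
    rw [Set.disjoint_left]
    rintro v hv1 hv4
    obtain ⟨w₁, hw₁, ev1, nv1⟩ := normY hv1 hT₁
    obtain ⟨w₄, hw₄, ev4, nv4⟩ := normY hv4 hT₄
    have hann : (n : ℤ) ≤ triNorm v ∧ triNorm v ≤ N := by
      by_contra hc
      have hout : triNorm v < n ∨ (N : ℤ) < triNorm v := by omega
      have c1 := (hT₁ hw₁).2.2 (by rw [← nv1]; exact hout)
      have c4 := (hT₄ hw₄).2.2 (by rw [← nv4]; exact hout)
      obtain ⟨-, -, f10, f11, -⟩ := rot_apply_formula w₁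
      obtain ⟨-, -, -, -, -, -, -, -, f40, f41, -⟩ := rot_apply_formula w₄
      rw [mem_triCone] at c1 c4
      have e14 : triRotIsoPow 1 w₁ = triRotIsoPow 4 w₄ := by rw [← ev1, ← ev4]
      have h0 : (triRotIsoPow 1 w₁) 0 = (triRotIsoPow 4 w₄) 0 := by rw [e14]
      rw [f10, f40] at h0
      omega
    -- paths of `ωᶜ` from `v` to the sides `1` and `4`
    obtain ⟨y₁, hy₁, P₁⟩ := R₁ w₁ hw₁ (by rw [← nv1]; exact hann.2)
    obtain ⟨y₄, hy₄, P₄⟩ := R₄ w₄ hw₄ (by rw [← nv4]; exact hann.2)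
    have hy₁T := side0_of_mem_sepConeSupport (hT₁ P₁.right_mem.2) hy₁ (Or.inr (by rw [hy₁]; omega))
    have hy₄T := side0_of_mem_sepConeSupport (hT₄ P₄.right_mem.2) hy₄ (Or.inr (by rw [hy₄]; omega))
    set B : Set (Site 2) := Y₁ ∪ Y₄ with hB
    have Q₁ : PathIn triGraph ((↑(triBall K) : Set (Site 2)) ∩ B) v (triRotIsoPow 1 y₁) := by
      have h := pathIn_image_rot (i := 1) P₁
      rw [← ev1] at h
      exact h.mono fun z hz => ⟨image_rot_triBall 1 K hz.1, Or.inl hz.2⟩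
    have Q₄ : PathIn triGraph ((↑(triBall K) : Set (Site 2)) ∩ B) v (triRotIsoPow 4 y₄) := by
      have h := pathIn_image_rot (i := 4) P₄
      rw [← ev4] at h
      exact h.mono fun z hz => ⟨image_rot_triBall 4 K hz.1, Or.inr hz.2⟩
    have hP : PathIn triGraph ((↑(triBall K) : Set (Site 2)) ∩ B) (triRotIsoPow 1 y₁) (triRotIsoPow 4 y₄) := Q₁.symm.trans Q₄
    -- paths of `ω` (off `B ⊆ ωᶜ`) from the sides `3`, `0` to the hole, and the hole path
    have hBω : B ⊆ ωᶜ := by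
      rintro z (⟨w, hw, rfl⟩ | ⟨w, hw, rfl⟩)
      · have := hχ₁ hw; rw [mem_rotConfig] at this; exact this
      · have := hχ₄ hw; rw [mem_rotConfig] at this; exact this
    have hu₀n : triNorm u₀ ≤ N := by
      have : triNorm u₀ ≤ (n : ℤ) - 1 := triNorm_le_iff_lin.2 (by omega)
      omega
    have hu₃n : triNorm u₃ ≤ N := by
      have : triNorm u₃ ≤ (n : ℤ) - 1 := triNorm_le_iff_lin.2 (by omega)
      omega
    obtain ⟨x₀, hx₀, P₀⟩ := R₀ u₀ hu₀ hu₀n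
    obtain ⟨x₃, hx₃, P₃⟩ := R₃ u₃ hu₃ hu₃n
    have hx₀T := side0_of_mem_sepConeSupport (hT₀ P₀.right_mem.2) hx₀ (Or.inr (by rw [hx₀]; omega))
    have hx₃T := side0_of_mem_sepConeSupport (hT₃ P₃.right_mem.2) hx₃ (Or.inr (by rw [hx₃]; omega))
    have offB : ∀ {i : ℕ} {X : Set (Site 2)}, X ⊆ rotConfig i ω → ∀ z ∈ triRotIsoPow i '' X, z ∉ B := by
      rintro i X hX _ ⟨w, hw, rfl⟩ hzB
      have h1 := hX hw; rw [mem_rotConfig] at h1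
      exact hBω hzB h1
    have Q₀ : PathIn triGraph ((↑(triBall K) : Set (Site 2)) ∩ Bᶜ) (triRotIsoPow 0 u₀) (triRotIsoPow 0 x₀) := by
      have h := pathIn_image_rot (i := 0) P₀
      exact h.mono fun z hz => ⟨image_rot_triBall 0 K hz.1, offB hχ₀ z hz.2⟩
    have Q₃ : PathIn triGraph ((↑(triBall K) : Set (Site 2)) ∩ Bᶜ) (triRotIsoPow 3 x₃) (triRotIsoPow 3 u₃) := by
      have h := pathIn_image_rot (i := 3) P₃
      refine (h.mono ?_).symm
      exact fun z hz => ⟨image_rot_triBall 3 K hz.1, offB hχ₃ z hz.2⟩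
    obtain ⟨f00, f01, -, -, -, -, -⟩ := rot_apply_formula u₀
    obtain ⟨-, -, -, -, -, -, g30, g31, -⟩ := rot_apply_formula u₃
    have hu₀max := triNorm_eq_max u₀
    have hu₃max := triNorm_eq_max u₃
    have H : PathIn triGraph ((↑(triBall K) : Set (Site 2)) ∩ Bᶜ) (triRotIsoPow 0 u₀) (triRotIsoPow 3 u₃) := by
      refine hole_path_03 hn (S := (↑(triBall K) : Set (Site 2)) ∩ Bᶜ) (fun z hz hc1 hc4 => ⟨?_, fun hzB => ?_⟩) ?_ ?_ ?_ ?_ ?_ ?_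
      · exact Finset.mem_coe.2 (mem_triBall_iff.2 (by rw [hK]; push_cast; omega))
      · rcases hzB with hzB | hzB
        · obtain ⟨w, hw, ez, nz⟩ := normY hzB hT₁
          have hs := hT₁ hw
          rw [mem_sepConeSupport] at hs
          have hc := hs.2.2 (Or.inl (by rw [← nz]; omega))
          obtain ⟨-, -, e10, e11, -⟩ := rot_apply_formula w
          rw [ez] at hc1
          apply hc1
          rw [e10, e11]; omega
        · obtain ⟨w, hw, ez, nz⟩ := normY hzB hT₄
          have hs := hT₄ hw
          rw [mem_sepConeSupport] at hs
          have hc := hs.2.2 (Or.inl (by rw [← nz]; omega))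
          obtain ⟨-, -, -, -, -, -, -, -, e40, e41, -⟩ := rot_apply_formula w
          rw [ez] at hc4
          apply hc4
          rw [e40, e41]; omega
      · rw [f00]; omega
      · rw [f01]; omega
      · rw [triNorm_rot]; exact triNorm_le_iff_lin.2 (by omega)
      · rw [g30]; omega
      · rw [g31]; omega
      · rw [triNorm_rot]; exact triNorm_le_iff_lin.2 (by omega)
    have hQ : PathIn triGraph ((↑(triBall K) : Set (Site 2)) ∩ Bᶜ) (triRotIsoPow 3 x₃) (triRotIsoPow 0 x₀) := (Q₃.trans H.symm).trans Q₀
    obtain ⟨ex0, l0, r0⟩ := hx₀T; obtain ⟨ex3, l3, r3⟩ := hx₃T; obtain ⟨ey1, l1, r1⟩ := hy₁T; obtain ⟨ey4, l4, r4⟩ := hy₄T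
    have b0 := hexPos_rot_block (K := K) (i := 0) (by norm_num) l0 r0
    have b3 := hexPos_rot_block (K := K) (i := 3) (by norm_num) l3 r3
    have b1 := hexPos_rot_block (K := K) (i := 1) (by norm_num) l1 r1
    have b4 := hexPos_rot_block (K := K) (i := 4) (by norm_num) l4 r4
    have n0 : triNorm (triRotIsoPow 0 ![(K : ℤ), x₀ 1]) = K := by rw [triNorm_rot, ← ex0, hx₀]
    have n3 : triNorm (triRotIsoPow 3 ![(K : ℤ), x₃ 1]) = K := by rw [triNorm_rot, ← ex3, hx₃]
    have n1 : triNorm (triRotIsoPow 1 ![(K : ℤ), y₁ 1]) = K := by rw [triNorm_rot, ← ey1, hy₁]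
    have n4 : triNorm (triRotIsoPow 4 ![(K : ℤ), y₄ 1]) = K := by rw [triNorm_rot, ← ey4, hy₄]
    rw [ey1, ey4] at hP
    rw [ex3, ex0] at hQ
    push_cast at b0 b3 b1 b4
    exact triBall_not_interleaved_shift hK1 B n1 n1 n3 n4 n0 (hexShift_self_lt (by linarith [b1.2, b3.1]))
      (hexShift_lt_of_le_of_lt (by linarith [b1.2, b3.1]) (by linarith [b3.2, b4.1]))
      (hexShift_lt_wrap (by linarith [b1.2, b4.1]) (by linarith [b4.2]) (by linarith [b0.2, b1.1]) (by linarith [b0.1])) hP hQ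
  -- (C) assemble
  refine ⟨⟨Y₀, Y₃, hD03, memAt 0 true X₀ (by rw [hωt]; exact hA₀), memAt 3 true X₃ (by rw [hωt]; exact hA₃)⟩,
    ⟨Y₁, Y₄, hD14, memAt 1 false X₁ (by rw [hωf]; exact hA₁), memAt 4 false X₄ (by rw [hωf]; exact hA₄)⟩⟩

end Literature.Probability.Percolation
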